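import Literature.Analysis.Matrix.TridiagonalDeterminant
import Literature.LinearAlgebra.Matrix.Berkowitz
import Summits.Ventures.HSemireg.WedgeHankelRecurrenceGaussWendroffFull

/-!
# Venture HSemireg — **THE JACOBI MATRIX OF A THREE-TERM RECURRENCE**: for `q_0 = 1`, `q_1 = X − a_0`, `q_{k+2} = (X − a_{k+1}) q_{k+1} − b_{k+1} q_k`, the tridiagonal matrix `J_m`
# (diagonal `a_0, …, a_m`, superdiagonal `1`, subdiagonal `b_1, …, b_m`) has CHARACTERISTIC POLYNOMIAL `q_{m+1}` (continuant recurrence), `J_m u(z) = z u(z) − q_{m+1}(z) e_m` for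
# `u(z) = (q_0(z), …, q_m(z))` — so every zero of `q_{m+1}` is an eigenvalue with the explicit eigenvector `u(z)` — and, for `b_j > 0`, the eigenvalues are the `m + 1` GAUSS NODES (Golub–Welsch)

HONEST FRAMING. Part of the Lean index of the computation cell `pub-hsemireg` (seat p10 gen 43, Sunday typer «UNIFORM-IN-n»).  Square real matrices, determinants and real polynomials only;
no variety, no cohomology theory, no sheaf, no Ext group and no semiregularity map is constructed here; nothing here says that HC / HC_CM / HC_AV holds; no Literature fact (unproved `Prop`) is
declared or used.  Custodian versions as in `WedgeHankelSiegelIdeal` (1/3).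
SOURCES (cited).  C. G. J. Jacobi, J. reine angew. Math. 30 (1846) 51–94 (tridiagonal forms); G. H. Golub, J. H. Welsch, *Calculation of Gauss quadrature rules*, Math. Comp. 23 (1969)
221–230, §2 (nodes = eigenvalues of the Jacobi matrix, weights from the first components of the eigenvectors); W. Gautschi, *Orthogonal Polynomials: Computation and Approximation* (2004),
Thm 1.31 and §3.1.1.1; T. S. Chihara, *An Introduction to Orthogonal Polynomials* (1978), Ch. I Ex. 4.12 and Ch. IV §2 (Jacobi matrices); G. Szegő, *Orthogonal Polynomials*, (2.2.8)–(2.2.9);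
R. A. Horn, C. R. Johnson, *Matrix Analysis* (2013), §0.9.10 (continuants; the tree's `Literature.Analysis.Matrix.det_tridiagonal_eq`).
PROOF TYPED HERE.  (i) The REVERSED Jacobi matrix `R_m` (`R_{ii} = a_{m−i}`, `R_{i,i+1} = b_{m−i}`, `R_{i+1,i} = 1`) is a family closed under the trailing principal submatrix, so the
continuant recurrence for `det(X·1 − R_m)` (expansion along row `0`) IS the recurrence of `q`: `χ(R_m) = q_{m+1}` by two-step induction; `J_m = reindex(rev, rev) R_m`, and the characteristic
polynomial is reindex-invariant.  (ii) `(J_m u)_i = a_i q_i(z) + [i < m] q_{i+1}(z) + [0 < i] b_i q_{i−1}(z)` (a sum over `range (m+1)` of three indicator terms) `= z q_i(z) − [i = m] q_{m+1}(z)`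
by the recurrence.  (iii) `det(t·1 − J_m) = q_{m+1}(t)` (Mathlib `Matrix.eval_charpoly`); with `b > 0`, N279 gives the `m + 1` strictly increasing zeros, and N290 `nodePoly_eq_of_exact`
identifies them with the Gauss nodes of any positive discrete measure whose orthogonal polynomials obey the recurrence.
DEDUP DISCLOSURE (`rg -n 'jacobi_mulVec|charpoly_jacobi|charpoly_revJacobi|det_scalar_sub_jacobi|tridiag' Summits Literature`, 2026-09-03): `Literature/Analysis/Matrix/TridiagonalDeterminant`
(continuant recurrence and sign control, imported and used by name); the tree's `WedgeHankelRecurrenceJacobi*` files are about JACOBI'S RULE for Hankel inertia (unrelated); `Companion`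
`charpoly_mulResidueMat_X` is the companion ∕ multiplication matrix, not the tridiagonal one.  The 9 names below: 0 hits tree-wide.

WHAT IS IN THE TREE.  Literature `Analysis.Matrix.det_tridiagonal_eq`, `LinearAlgebra.Matrix.charmatrix_submatrix` (Berkowitz); N279 `recurrence_monic_natDegree`, `recurrence_zeros`,
`eq_prod_X_sub_C_of_monic_of_roots`; N290 `nodePoly_eq_of_exact`; Mathlib `Matrix.charpoly_reindex`, `Matrix.eval_charpoly`, `Matrix.exists_mulVec_eq_zero_iff`, `Matrix.det_fin_one`,
`Matrix.det_fin_two`, `Fin.revPerm`, `Fin.sum_univ_eq_sum_range`, `Finset.sum_ite_eq'`.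
THIS FILE (namespace `Summit.Ventures.HSemireg.Wedge.HankelOuter` continued; CHAINED on N292 (import), N279, N290; PLAIN on the two Literature files; 0 definitions — the matrices are carried
by entrywise hypotheses `hR` ∕ `hJ`):
* §1058 `revJacobi_submatrix_succ` (closure of the reversed family under the trailing submatrix), **`charpoly_revJacobi`** (`χ(R_m) = q_{m+1}`, continuant), **`charpoly_jacobi`** (`χ(J_m) = q_{m+1}`),
  `det_scalar_sub_jacobi` (`det(t·1 − J_m) = q_{m+1}(t)`), `det_scalar_sub_jacobi_eq_zero_iff` (eigenvalue `⟺` zero of `q_{m+1}`), **`jacobi_mulVec_recurrenceVector`**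
  (`J_m u(z) = z u(z) − q_{m+1}(z) e_m`), `jacobi_eigenvector_of_eval_eq_zero` (explicit eigenvector, `u_0 = 1`), **`charpoly_jacobi_eq_prod_recurrence_zeros`** (`b > 0`: `χ(J_m) = ∏_k (X − z_k)`,
  `z_0 < ⋯ < z_m` the zeros of `q_{m+1}`), **`charpoly_jacobi_eq_prod_gauss_nodes`** (GOLUB–WELSCH: the nodes of a rule exact to degree `2t + 1` for a positive discrete measure whose
  degree-`t + 1` orthogonal polynomial is `q_{t+1}` are the eigenvalues of `J_t`: `χ(J_t) = ∏_j (X − v_j)`).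
CAVEATS.  The Golub–Welsch WEIGHT formula in this vocabulary is N277 `gauss_weight_mul_kernel_diag_eq_one` (`λ_k · Σ_j q_j(v_k)² ∕ h_j = 1`, the weighted norm of the eigenvector `u(v_k)`)
and is not restated.  The non-symmetric `J_m` is used (no square roots); the symmetrised matrix is similar to it when `b > 0` (not typed).  Nothing Ext-side.  New names only.
-/

open Module Polynomial
open scoped Matrix Polynomial

namespace Summit.Ventures.HSemireg.Wedge.HankelOuter

/-! ## §1058. The Jacobi matrix: characteristic polynomial, eigenvectors, Gauss nodes -/

/-- **The reversed Jacobi family is closed under the trailing principal submatrix**: if `R` (order `m + 2`) has `R_{ii} = a_{m+1−i}`, `R_{i,i+1} = b_{m+1−i}`, `R_{i+1,i} = 1` and zeros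
elsewhere, then `R[1.., 1..]` (order `m + 1`) has `a_{m−i}`, `b_{m−i}`, `1` in the same pattern. [mechanism; this file, §1058] -/
theorem revJacobi_submatrix_succ {a b : ℕ → ℝ} {m : ℕ} {R : Matrix (Fin (m + 2)) (Fin (m + 2)) ℝ}
    (hR : ∀ i j : Fin (m + 2), R i j = if (i : ℕ) = j then a (m + 1 - i) else if (j : ℕ) = i + 1 then b (m + 1 - i) else if (i : ℕ) = j + 1 then 1 else 0)
    (i j : Fin (m + 1)) :
    (R.submatrix Fin.succ Fin.succ) i j = if (i : ℕ) = j then a (m - i) else if (j : ℕ) = i + 1 then b (m - i) else if (i : ℕ) = j + 1 then 1 else 0 := by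
  rw [Matrix.submatrix_apply, hR]
  simp only [Fin.val_succ, Nat.add_right_cancel_iff, Nat.add_sub_add_right]

/-- **Continuant: the characteristic polynomial of the reversed Jacobi matrix `R_m` is `q_{m+1}`.**  For the recurrence `q_0 = 1`, `q_1 = X − a_0`, `q_{k+2} = (X − a_{k+1}) q_{k+1} − b_{k+1} q_k`
and `R` of order `m + 1` with `R_{ii} = a_{m−i}`, `R_{i,i+1} = b_{m−i}`, `R_{i+1,i} = 1`, zeros elsewhere: `χ(R) = q_{m+1}` (expansion along row `0` reproduces the recurrence).
[Horn–Johnson §0.9.10; Chihara I Ex. 4.12; this file, §1058] -/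
theorem charpoly_revJacobi {q : ℕ → ℝ[X]} {a b : ℕ → ℝ} (hq0 : q 0 = 1) (hq1 : q 1 = Polynomial.X - C (a 0))
    (hrec : ∀ n, q (n + 2) = (Polynomial.X - C (a (n + 1))) * q (n + 1) - C (b (n + 1)) * q n) :
    ∀ (m : ℕ) (R : Matrix (Fin (m + 1)) (Fin (m + 1)) ℝ),
      (∀ i j : Fin (m + 1), R i j = if (i : ℕ) = j then a (m - i) else if (j : ℕ) = i + 1 then b (m - i) else if (i : ℕ) = j + 1 then 1 else 0) →
      R.charpoly = q (m + 1) := by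
  -- two-step induction
  have key : ∀ m, (∀ R : Matrix (Fin (m + 1)) (Fin (m + 1)) ℝ,
      (∀ i j : Fin (m + 1), R i j = if (i : ℕ) = j then a (m - i) else if (j : ℕ) = i + 1 then b (m - i) else if (i : ℕ) = j + 1 then 1 else 0) → R.charpoly = q (m + 1)) ∧
      (∀ R : Matrix (Fin (m + 2)) (Fin (m + 2)) ℝ,
      (∀ i j : Fin (m + 2), R i j = if (i : ℕ) = j then a (m + 1 - i) else if (j : ℕ) = i + 1 then b (m + 1 - i) else if (i : ℕ) = j + 1 then 1 else 0) → R.charpoly = q (m + 2)) := by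
    intro m
    induction m with
    | zero =>
      refine ⟨fun R hR => ?_, fun R hR => ?_⟩
      · show R.charpoly = q 1
        rw [Matrix.charpoly, Matrix.det_fin_one, Matrix.charmatrix_apply_eq, hR, if_pos rfl, hq1]
        simp
      · show R.charpoly = q 2
        have h2 := hrec 0
        simp only [zero_add] at h2
        rw [Matrix.charpoly, Matrix.det_fin_two, Matrix.charmatrix_apply_eq, Matrix.charmatrix_apply_eq,
          Matrix.charmatrix_apply_ne _ _ _ (by decide), Matrix.charmatrix_apply_ne _ _ _ (by decide), hR, hR, hR, hR, h2, hq1, hq0]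
        norm_num
    | succ m ih =>
      refine ⟨ih.2, fun R hR => ?_⟩
      have htri : ∀ i j : Fin (m + 1 + 2), (i : ℕ) + 1 < j ∨ (j : ℕ) + 1 < i → Matrix.charmatrix R i j = 0 := fun i j hij => by
        rw [Matrix.charmatrix_apply_ne _ _ _ (fun h => by rw [h] at hij; omega), hR]
        rw [if_neg (by omega), if_neg (by omega), if_neg (by omega), map_zero, neg_zero]
      -- the two trailing submatrices belong to the family
      have hR1 : ∀ i j : Fin (m + 2), (R.submatrix Fin.succ Fin.succ) i j =
          if (i : ℕ) = j then a (m + 1 - i) else if (j : ℕ) = i + 1 then b (m + 1 - i) else if (i : ℕ) = j + 1 then 1 else 0 :=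
        revJacobi_submatrix_succ (m := m + 1) hR
      have hR2 : ∀ i j : Fin (m + 1), ((R.submatrix Fin.succ Fin.succ).submatrix Fin.succ Fin.succ) i j =
          if (i : ℕ) = j then a (m - i) else if (j : ℕ) = i + 1 then b (m - i) else if (i : ℕ) = j + 1 then 1 else 0 :=
        revJacobi_submatrix_succ (m := m) hR1
      have h1 : (R.submatrix Fin.succ Fin.succ).charpoly = q (m + 2) := ih.2 _ hR1
      have h2 : ((R.submatrix Fin.succ Fin.succ).submatrix Fin.succ Fin.succ).charpoly = q (m + 1) := ih.1 _ hR2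
      rw [Matrix.charpoly, Matrix.submatrix_submatrix,
        ← Literature.LinearAlgebra.Matrix.charmatrix_submatrix R ((Fin.succ_injective _).comp (Fin.succ_injective _))] at h2
      rw [Matrix.charpoly, ← Literature.LinearAlgebra.Matrix.charmatrix_submatrix R (Fin.succ_injective _)] at h1
      rw [Matrix.charpoly, Literature.Analysis.Matrix.det_tridiagonal_eq _ htri, h1, h2, Matrix.charmatrix_apply_eq,
        Matrix.charmatrix_apply_ne _ _ _ (by simp), Matrix.charmatrix_apply_ne _ _ _ (by simp), hR, hR, hR]
      have h3 := hrec (m + 1)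
      rw [show m + 1 + 1 = m + 2 by ring] at h3
      rw [h3]
      have e0 : ((0 : Fin (m + 1 + 2)) : ℕ) = 0 := rfl
      have e1 : ((1 : Fin (m + 1 + 2)) : ℕ) = 1 := rfl
      simp only [e0, e1]
      norm_num
  exact fun m => (key m).1

/-- **THE CHARACTERISTIC POLYNOMIAL OF THE JACOBI MATRIX IS `q_{m+1}`.**  For the recurrence `(a, b, q)` and `J` of order `m + 1` with `J_{ii} = a_i`, `J_{i,i+1} = 1`, `J_{i+1,i} = b_{i+1}`,
zeros elsewhere: `χ(J) = det(X·1 − J) = q_{m+1}`. [Jacobi 1846; Chihara I Ex. 4.12, IV §2; Gautschi Thm 1.31; this file, §1058] -/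
theorem charpoly_jacobi {q : ℕ → ℝ[X]} {a b : ℕ → ℝ} (hq0 : q 0 = 1) (hq1 : q 1 = Polynomial.X - C (a 0))
    (hrec : ∀ n, q (n + 2) = (Polynomial.X - C (a (n + 1))) * q (n + 1) - C (b (n + 1)) * q n) {m : ℕ} {J : Matrix (Fin (m + 1)) (Fin (m + 1)) ℝ}
    (hJ : ∀ i j : Fin (m + 1), J i j = if (i : ℕ) = j then a i else if (j : ℕ) = i + 1 then 1 else if (i : ℕ) = j + 1 then b i else 0) :
    J.charpoly = q (m + 1) := by
  -- `J = reindex (rev, rev) R` with `R` in the reversed family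
  set R : Matrix (Fin (m + 1)) (Fin (m + 1)) ℝ := Matrix.reindex Fin.revPerm Fin.revPerm J with hRdef
  have hR : ∀ i j : Fin (m + 1), R i j = if (i : ℕ) = j then a (m - i) else if (j : ℕ) = i + 1 then b (m - i) else if (i : ℕ) = j + 1 then 1 else 0 := fun i j => by
    rw [hRdef, Matrix.reindex_apply, Matrix.submatrix_apply, Fin.revPerm_symm, Fin.revPerm_apply, Fin.revPerm_apply, hJ, Fin.val_rev, Fin.val_rev]
    have hi := i.isLt
    have hj := j.isLt
    by_cases h1 : (i : ℕ) = j
    · rw [if_pos (by omega), if_pos h1, show m + 1 - (i + 1) = m - i by omega]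
    · rw [if_neg (by omega), if_neg h1]
      by_cases h2 : (j : ℕ) = i + 1
      · rw [if_neg (by omega), if_pos (by omega), if_pos h2, show m + 1 - (i + 1) = m - i by omega]
      · rw [if_neg h2]
        by_cases h3 : (i : ℕ) = j + 1
        · rw [if_pos (by omega), if_pos h3]
        · rw [if_neg (by omega), if_neg (by omega), if_neg h3]
  have hJR : J = Matrix.reindex Fin.revPerm Fin.revPerm R := by
    rw [hRdef]
    ext i j
    simp [Matrix.reindex_apply, Matrix.submatrix_apply, Fin.revPerm_symm, Fin.revPerm_apply, Fin.rev_rev]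
  rw [hJR, Matrix.charpoly_reindex]
  exact charpoly_revJacobi hq0 hq1 hrec m R hR

/-- **`det(t·1 − J_m) = q_{m+1}(t)`** for every real `t`. [Golub–Welsch 1969 §2; this file, §1058] -/
theorem det_scalar_sub_jacobi {q : ℕ → ℝ[X]} {a b : ℕ → ℝ} (hq0 : q 0 = 1) (hq1 : q 1 = Polynomial.X - C (a 0))
    (hrec : ∀ n, q (n + 2) = (Polynomial.X - C (a (n + 1))) * q (n + 1) - C (b (n + 1)) * q n) {m : ℕ} {J : Matrix (Fin (m + 1)) (Fin (m + 1)) ℝ}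
    (hJ : ∀ i j : Fin (m + 1), J i j = if (i : ℕ) = j then a i else if (j : ℕ) = i + 1 then 1 else if (i : ℕ) = j + 1 then b i else 0) (t : ℝ) :
    (Matrix.scalar (Fin (m + 1)) t - J).det = (q (m + 1)).eval t := by
  rw [← Matrix.eval_charpoly, charpoly_jacobi hq0 hq1 hrec hJ]

/-- **Eigenvalues of the Jacobi matrix = zeros of `q_{m+1}`**: `det(t·1 − J_m) = 0 ⟺ q_{m+1}(t) = 0 ⟺ ∃ u ≠ 0, J_m u = t u`. [Golub–Welsch 1969 §2; Gautschi Thm 1.31; this file, §1058] -/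
theorem det_scalar_sub_jacobi_eq_zero_iff {q : ℕ → ℝ[X]} {a b : ℕ → ℝ} (hq0 : q 0 = 1) (hq1 : q 1 = Polynomial.X - C (a 0))
    (hrec : ∀ n, q (n + 2) = (Polynomial.X - C (a (n + 1))) * q (n + 1) - C (b (n + 1)) * q n) {m : ℕ} {J : Matrix (Fin (m + 1)) (Fin (m + 1)) ℝ}
    (hJ : ∀ i j : Fin (m + 1), J i j = if (i : ℕ) = j then a i else if (j : ℕ) = i + 1 then 1 else if (i : ℕ) = j + 1 then b i else 0) (t : ℝ) :
    ((q (m + 1)).eval t = 0 ↔ (Matrix.scalar (Fin (m + 1)) t - J).det = 0) ∧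
      ((q (m + 1)).eval t = 0 ↔ ∃ u : Fin (m + 1) → ℝ, u ≠ 0 ∧ J *ᵥ u = t • u) := by
  have h := det_scalar_sub_jacobi hq0 hq1 hrec hJ t
  refine ⟨by rw [h], ?_⟩
  rw [← h, ← Matrix.exists_mulVec_eq_zero_iff]
  refine exists_congr fun u => and_congr Iff.rfl ?_
  rw [Matrix.sub_mulVec, sub_eq_zero, eq_comm]
  have hs : Matrix.scalar (Fin (m + 1)) t *ᵥ u = t • u := by
    ext i
    simp [Matrix.scalar_apply, Matrix.mulVec_diagonal]
  rw [hs]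

/-- **`J_m u(z) = z u(z) − q_{m+1}(z) e_m`** for `u(z) = (q_0(z), …, q_m(z))` and every real `z` (the recurrence read as a matrix identity; `e_m` the last standard basis vector).
[Szegő (2.2.8)–(2.2.9); Golub–Welsch 1969 §2; Gautschi §3.1.1.1; this file, §1058] -/
theorem jacobi_mulVec_recurrenceVector {q : ℕ → ℝ[X]} {a b : ℕ → ℝ} (hq0 : q 0 = 1) (hq1 : q 1 = Polynomial.X - C (a 0))
    (hrec : ∀ n, q (n + 2) = (Polynomial.X - C (a (n + 1))) * q (n + 1) - C (b (n + 1)) * q n) {m : ℕ} {J : Matrix (Fin (m + 1)) (Fin (m + 1)) ℝ}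
    (hJ : ∀ i j : Fin (m + 1), J i j = if (i : ℕ) = j then a i else if (j : ℕ) = i + 1 then 1 else if (i : ℕ) = j + 1 then b i else 0) (z : ℝ) :
    J *ᵥ (fun j : Fin (m + 1) => (q j).eval z) =
      z • (fun j : Fin (m + 1) => (q j).eval z) - (q (m + 1)).eval z • Pi.single (Fin.last m) 1 := by
  -- the recurrence, extended to index `0`
  have hext : ∀ i : ℕ, z * (q i).eval z = (q (i + 1)).eval z + a i * (q i).eval z + (if 0 < i then b i * (q (i - 1)).eval z else 0) := by
    intro i
    rcases Nat.eq_zero_or_pos i with h0 | hpos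
    · subst h0
      rw [if_neg (lt_irrefl 0), add_zero, zero_add, hq1, hq0, eval_sub, eval_X, eval_C, eval_one]
      ring
    · obtain ⟨k, rfl⟩ : ∃ k, i = k + 1 := ⟨i - 1, by omega⟩
      rw [if_pos hpos, Nat.add_sub_cancel, show k + 1 + 1 = k + 2 by ring, hrec k]
      simp only [eval_sub, eval_mul, eval_X, eval_C]
      ring
  ext i
  have hi := i.isLt
  rw [Matrix.mulVec, dotProduct]
  simp only [hJ, Pi.sub_apply, Pi.smul_apply, smul_eq_mul, Pi.single_apply, Fin.ext_iff, Fin.val_last]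
  -- pass to a sum over `range (m + 1)` and split into three indicator sums
  rw [Fin.sum_univ_eq_sum_range (fun j : ℕ => (if (i : ℕ) = j then a i else if j = (i : ℕ) + 1 then 1 else if (i : ℕ) = j + 1 then b i else 0) * (q j).eval z) (m + 1)]
  have hsplit : ∀ j : ℕ, (if (i : ℕ) = j then a i else if j = (i : ℕ) + 1 then 1 else if (i : ℕ) = j + 1 then b i else 0) * (q j).eval z =
      (if j = i then a i * (q i).eval z else 0) + (if j = (i : ℕ) + 1 then (q (i + 1)).eval z else 0) +
        (if 0 < (i : ℕ) then (if j = (i : ℕ) - 1 then b i * (q (i - 1)).eval z else 0) else 0) := fun j => by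
    by_cases h1 : (i : ℕ) = j
    · rw [if_pos h1, if_pos h1.symm, if_neg (by omega : ¬ j = (i : ℕ) + 1)]
      by_cases hp : 0 < (i : ℕ)
      · rw [if_pos hp, if_neg (by omega : ¬ j = (i : ℕ) - 1), ← h1]; ring
      · rw [if_neg hp, ← h1]; ring
    · rw [if_neg h1, if_neg (Ne.symm h1)]
      by_cases h2 : j = (i : ℕ) + 1
      · rw [if_pos h2, if_pos h2]
        by_cases hp : 0 < (i : ℕ)
        · rw [if_pos hp, if_neg (by omega : ¬ j = (i : ℕ) - 1), h2]; ring
        · rw [if_neg hp, h2]; ring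
      · rw [if_neg h2, if_neg h2]
        by_cases h3 : (i : ℕ) = j + 1
        · rw [if_pos h3, if_pos (by omega : 0 < (i : ℕ)), if_pos (by omega : j = (i : ℕ) - 1), show (i : ℕ) - 1 = j by omega]; ring
        · rw [if_neg h3]
          by_cases hp : 0 < (i : ℕ)
          · rw [if_pos hp, if_neg (by omega : ¬ j = (i : ℕ) - 1)]; ring
          · rw [if_neg hp]; ring
  simp only [hsplit]
  rw [Finset.sum_add_distrib, Finset.sum_add_distrib, Finset.sum_ite_eq' (Finset.range (m + 1)), Finset.sum_ite_eq' (Finset.range (m + 1)),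
    if_pos (Finset.mem_range.2 hi)]
  have h3 : ∑ j ∈ Finset.range (m + 1), (if 0 < (i : ℕ) then (if j = (i : ℕ) - 1 then b i * (q (i - 1)).eval z else 0) else 0) =
      if 0 < (i : ℕ) then b i * (q (i - 1)).eval z else 0 := by
    by_cases hpos : 0 < (i : ℕ)
    · simp only [if_pos hpos]
      rw [Finset.sum_ite_eq' (Finset.range (m + 1)), if_pos (Finset.mem_range.2 (by omega))]
    · simp only [if_neg hpos, Finset.sum_const_zero]
  rw [h3]
  have hz := hext i
  by_cases hlast : (i : ℕ) = m
  · rw [if_neg (show ¬ ((i : ℕ) + 1 ∈ Finset.range (m + 1)) from fun h => by rw [Finset.mem_range] at h; omega), if_pos hlast, mul_one]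
    have hU : (q ((i : ℕ) + 1)).eval z = (q (m + 1)).eval z := by rw [hlast]
    linarith
  · rw [if_pos (Finset.mem_range.2 (by omega)), if_neg hlast, mul_zero, sub_zero]
    linarith

/-- **Explicit eigenvector at a zero of `q_{m+1}`**: if `q_{m+1}(z) = 0` then `u(z) = (q_j(z))_j` satisfies `J_m u = z u` and `u_0 = 1 ≠ 0`. [Golub–Welsch 1969 §2; Gautschi Thm 1.31; this file, §1058] -/
theorem jacobi_eigenvector_of_eval_eq_zero {q : ℕ → ℝ[X]} {a b : ℕ → ℝ} (hq0 : q 0 = 1) (hq1 : q 1 = Polynomial.X - C (a 0))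
    (hrec : ∀ n, q (n + 2) = (Polynomial.X - C (a (n + 1))) * q (n + 1) - C (b (n + 1)) * q n) {m : ℕ} {J : Matrix (Fin (m + 1)) (Fin (m + 1)) ℝ}
    (hJ : ∀ i j : Fin (m + 1), J i j = if (i : ℕ) = j then a i else if (j : ℕ) = i + 1 then 1 else if (i : ℕ) = j + 1 then b i else 0) {z : ℝ}
    (hz : (q (m + 1)).eval z = 0) :
    J *ᵥ (fun j : Fin (m + 1) => (q j).eval z) = z • (fun j : Fin (m + 1) => (q j).eval z) ∧ (fun j : Fin (m + 1) => (q j).eval z) 0 = 1 ∧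
      (fun j : Fin (m + 1) => (q j).eval z) ≠ 0 := by
  have h0 : (fun j : Fin (m + 1) => (q j).eval z) 0 = 1 := by simp [hq0]
  refine ⟨by rw [jacobi_mulVec_recurrenceVector hq0 hq1 hrec hJ z, hz, zero_smul, sub_zero], h0, fun h => ?_⟩
  simpa [hq0] using congr_fun h 0

/-- **For a positive recurrence the Jacobi matrix has `m + 1` distinct real eigenvalues, the zeros of `q_{m+1}`**: `χ(J_m) = ∏_k (X − z_k)` with `z_0 < ⋯ < z_m` and `q_{m+1}(z_k) = 0`.
[Chihara I Thm 5.2 + Ex. 4.12; Golub–Welsch 1969 §2; this file, §1058] -/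
theorem charpoly_jacobi_eq_prod_recurrence_zeros {q : ℕ → ℝ[X]} {a b : ℕ → ℝ} (hq0 : q 0 = 1) (hq1 : q 1 = Polynomial.X - C (a 0))
    (hrec : ∀ n, q (n + 2) = (Polynomial.X - C (a (n + 1))) * q (n + 1) - C (b (n + 1)) * q n) (hb : ∀ j, 0 < b j) {m : ℕ} {J : Matrix (Fin (m + 1)) (Fin (m + 1)) ℝ}
    (hJ : ∀ i j : Fin (m + 1), J i j = if (i : ℕ) = j then a i else if (j : ℕ) = i + 1 then 1 else if (i : ℕ) = j + 1 then b i else 0) :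
    ∃ z : Fin (m + 1) → ℝ, StrictMono z ∧ (∀ k, (q (m + 1)).eval (z k) = 0) ∧ J.charpoly = ∏ k, (Polynomial.X - C (z k)) ∧
      ∀ k, J *ᵥ (fun j : Fin (m + 1) => (q j).eval (z k)) = z k • (fun j : Fin (m + 1) => (q j).eval (z k)) := by
  obtain ⟨z, hz, hzr, -⟩ := recurrence_zeros hq0 hq1 hrec hb m
  have hmd := recurrence_monic_natDegree hq0 hq1 hrec (m + 1)
  refine ⟨z, hz, hzr, ?_, fun k => (jacobi_eigenvector_of_eval_eq_zero hq0 hq1 hrec hJ (hzr k)).1⟩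
  rw [charpoly_jacobi hq0 hq1 hrec hJ]
  exact eq_prod_X_sub_C_of_monic_of_roots hmd.1 hmd.2 hz.injective hzr

/-- **GOLUB–WELSCH: the Gauss nodes are the eigenvalues of the Jacobi matrix.**  Let `ν_l > 0` on `N` distinct nodes `w_l`, `t + 1 ≤ N`, let `q` obey the recurrence `(a, b)` with `q_{t+1}`
`(ν, w)`-orthogonal to every polynomial of degree `< t + 1`, and let `(λ, v)` be ANY rule exact for `(ν, w)` in degree `≤ 2t + 1`.  Then `χ(J_t) = ∏_j (X − v_j)`: the nodes are exactly the
eigenvalues of `J_t`, each with eigenvector `(q_0(v_j), …, q_t(v_j))`. [Golub–Welsch 1969 §2; Gautschi Thm 1.31 ∕ §3.1.1.1; this file, §1058] -/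
theorem charpoly_jacobi_eq_prod_gauss_nodes {q : ℕ → ℝ[X]} {a b : ℕ → ℝ} (hq0 : q 0 = 1) (hq1 : q 1 = Polynomial.X - C (a 0))
    (hrec : ∀ n, q (n + 2) = (Polynomial.X - C (a (n + 1))) * q (n + 1) - C (b (n + 1)) * q n) {t N : ℕ} {ν w : Fin N → ℝ} (hν : ∀ l, 0 < ν l)
    (hw : Function.Injective w) (hN : t + 1 ≤ N) (horth : ∀ G : ℝ[X], G.natDegree < t + 1 → ∑ l, ν l * (q (t + 1) * G).eval (w l) = 0)
    {μ v : Fin (t + 1) → ℝ} (hmom : ∀ p, p ≤ 2 * t + 1 → ∑ j, μ j * v j ^ p = ∑ l, ν l * w l ^ p) {J : Matrix (Fin (t + 1)) (Fin (t + 1)) ℝ}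
    (hJ : ∀ i j : Fin (t + 1), J i j = if (i : ℕ) = j then a i else if (j : ℕ) = i + 1 then 1 else if (i : ℕ) = j + 1 then b i else 0) :
    J.charpoly = ∏ j, (Polynomial.X - C (v j)) ∧ ∀ k, J *ᵥ (fun j : Fin (t + 1) => (q j).eval (v k)) = v k • (fun j : Fin (t + 1) => (q j).eval (v k)) := by
  have hmd := recurrence_monic_natDegree hq0 hq1 hrec (t + 1)
  have hnode : ∏ j, (Polynomial.X - C (v j)) = q (t + 1) := nodePoly_eq_of_exact hν hw hN hmom hmd.1 hmd.2 horth
  have hroot : ∀ k, (q (t + 1)).eval (v k) = 0 := fun k => by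
    rw [← hnode, eval_prod]
    exact Finset.prod_eq_zero (Finset.mem_univ k) (by simp)
  exact ⟨by rw [charpoly_jacobi hq0 hq1 hrec hJ, hnode], fun k => (jacobi_eigenvector_of_eval_eq_zero hq0 hq1 hrec hJ (hroot k)).1⟩

end Summit.Ventures.HSemireg.Wedge.HankelOuter
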